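import Mathlib
import HarnessLib
import Summits.RiemannHypothesis.RiemannHypothesis.Theorems.IntegerScrewRungCertKron
import Summits.RiemannHypothesis.RiemannHypothesis.Theorems.IntegerScrewRung128Data

/-!
# Route `IntegerScrew` — kernel certificate checker: the packed domination test straight from the PACKED factor rows

`IntegerScrewRungCertKron.zcheckRowsK` consumes the factor as `Lz : List (List ℤ)`; the data modules ship it as ONE natural number per row
(`RungCert.unpackRowsZ B O lzP 0`, base `B = 2^32`, offset `O = 2^31`), and every `decide` chunk then pays for decoding the rows into lists
(`≈ 4.4 s` of kernel at `N = 255`) and for packing them into Kronecker records list by list (`posPart`, `negPart`, `packN` ×2, `packRevN` ×2: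
`≈ 11.4 s`) — `≈ 16 s` of the `≈ 40 s` a single `decide +kernel` may use on the farm (measured 2026-08-25, this seat).  Here ONE structural
pass per row reads the base-`B` digits of the row's natural number and accumulates the four packs directly (`fusedGo` / `mkKRecPacked`,
direct `ℕ` primitives, no intermediate lists), and the chunk test `zcheckRowsKP` takes the packed rows; the per-row shape guards (`lzOK`,
`absBoundOK`) are NOT re-decided per chunk but taken as hypotheses of the soundness theorem (decided once in the light file):

* ★ `mkKRecPacked_eq : mkKRecPacked B O W n r k = mkKRec W n (RungCert.unpackZ B O r k)` (`k ≤ n`);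
* `ksPacked` / `ksPacked_eq : = (RungCert.unpackRowsZ B O lzP i₀).map (mkKRec W n)`;
* `zcheckRowsKP N utab lzP lamZ B O W i₀ cnt` and ★ `zrowW_of_rowsKP` (same verdicts as the tree's row tests, for
  `Lz = RungCert.unpackRowsZ B O lzP 0`; consumed unchanged by `posDef_of_rungW` / `posDef_of_rungW_mem`).

Nothing here bears on the truth of RH.  Reference: J. von zur Gathen, J. Gerhard, Modern Computer Algebra (2013) §8.4
[GathenGerhard2013ModernComputerAlgebra].
-/

set_option linter.dupNamespace false
set_option autoImplicit false

namespace Summit.RiemannHypothesis.RiemannHypothesis.Theorems.IntegerScrew.RungCert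

open Literature.NumberTheory.LFunctions Literature.Analysis.ValidatedNumerics Finset
open Literature.Analysis.ValidatedNumerics.Numerics Literature.Analysis.ValidatedNumerics.KroneckerDot

/-! ## One fused pass per row -/

/-- Read `k` base-`B` digits of `r` (least significant first; digit `d` encodes `d − O`) and accumulate: the little-endian packs
of the positive / negative parts (running power `w = W^j`) and their big-endian Horner accumulators. [cite: GathenGerhard2013ModernComputerAlgebra, §8.4] -/
def fusedGo (B O W : ℕ) : ℕ → ℕ → ℕ → ℕ → ℕ → ℕ → ℕ → ℕ × ℕ × ℕ × ℕ
  | 0, _, pP, pM, _, bP, bM => (pP, pM, bP, bM)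
  | k + 1, r, pP, pM, w, bP, bM =>
      let d := Nat.mod r B
      let ap := Nat.sub d O
      let am := Nat.sub O d
      fusedGo B O W k (Nat.div r B) (Nat.add pP (Nat.mul ap w)) (Nat.add pM (Nat.mul am w)) (Nat.mul w W)
        (Nat.add (Nat.mul bP W) ap) (Nat.add (Nat.mul bM W) am)

/-- The Kronecker record of a packed row of `k` digits, padded length `n`. [cite: GathenGerhard2013ModernComputerAlgebra, §8.4] -/
def mkKRecPacked (B O W n r k : ℕ) : KRec :=
  let t := fusedGo B O W k r 0 0 1 0 0
  ⟨t.1, t.2.1, t.2.2.1 * W ^ (n - k), t.2.2.2 * W ^ (n - k)⟩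

/-- The records of the packed ragged rows (row `i`, from `i₀` on, has `i + 1` digits). [folklore] -/
def ksPacked (B O W n : ℕ) : List ℕ → ℕ → List KRec
  | [], _ => []
  | r :: rs, i => mkKRecPacked B O W n r (i + 1) :: ksPacked B O W n rs (i + 1)

/-- **A chunk of packed row tests from the PACKED factor rows** (`lzP`): lengths, `0 < N`, then the row tests; the factor's shape
guards and the capacity are hypotheses of `zrowW_of_rowsKP` (decided once, not per chunk). [folklore] -/
def zcheckRowsKP (N : ℕ) (utab : List (List FI)) (lzP : List ℕ) (lamZ : ℤ) (B O W i₀ cnt : ℕ) : Bool :=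
  let D := dcol utab
  let Ks := ksPacked B O W N lzP 0
  decide (utab.length = N + 2) && decide (lzP.length = N) && decide (0 < N) &&
    rall cnt fun t => zrowSK W N utab D Ks lamZ (i₀ + t)

/-! ## The fused pass computes `mkKRec` of the decoded row -/

/-- Big-endian Horner accumulator (as a function, for the invariant). [folklore] -/
def packAccN (W : ℕ) : ℕ → List ℕ → ℕ
  | acc, [] => acc
  | acc, d :: ds => packAccN W (acc * W + d) ds

/-- The accumulator law. [folklore] -/
theorem packAccN_eq (W : ℕ) : ∀ (acc : ℕ) (ds : List ℕ), packAccN W acc ds = acc * W ^ ds.length + packAccN W 0 ds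
  | acc, [] => by simp [packAccN]
  | acc, d :: ds => by
      rw [packAccN, packAccN, packAccN_eq W (acc * W + d) ds, packAccN_eq W (0 * W + d) ds]
      simp only [List.length_cons, pow_succ, zero_mul, zero_add]
      ring

/-- `packRevN` by one Horner pass and one power (rows of length `≤ n`). [cite: GathenGerhard2013ModernComputerAlgebra, §8.4] -/
theorem packAccN_mul_pow_eq_packRevN (W : ℕ) : ∀ (n : ℕ) (bs : List ℕ), bs.length ≤ n →
    packAccN W 0 bs * W ^ (n - bs.length) = packRevN W n bs
  | n, [], _ => by simp [packAccN, packRevN]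
  | n, b :: bs, h => by
      have hlen : bs.length ≤ n - 1 := by simp only [List.length_cons] at h; omega
      have ih := packAccN_mul_pow_eq_packRevN W (n - 1) bs hlen
      rw [packRevN, ← ih, packAccN, packAccN_eq W (0 * W + b) bs]
      simp only [List.length_cons, zero_mul, zero_add]
      have e1 : n - 1 - bs.length = n - (bs.length + 1) := by omega
      have e2 : n - 1 = bs.length + (n - (bs.length + 1)) := by simp only [List.length_cons] at h; omega
      rw [e1, add_mul, mul_assoc, ← pow_add, ← e2]

/-- `((d : ℤ) − O).toNat = d − O` on naturals. [folklore] -/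
theorem toNat_natCast_sub (d O : ℕ) : (((d : ℤ) - O)).toNat = d - O := by
  rcases Nat.lt_or_ge d O with h | h
  · rw [Nat.sub_eq_zero_of_le h.le]
    exact Int.toNat_of_nonpos (by omega)
  · rw [show ((d : ℤ) - O) = ((d - O : ℕ) : ℤ) by push_cast [Nat.cast_sub h]; ring, Int.toNat_natCast]

/-- `(−((d : ℤ) − O)).toNat = O − d` on naturals. [folklore] -/
theorem toNat_neg_natCast_sub (d O : ℕ) : (-(((d : ℤ) - O))).toNat = O - d := by
  rw [neg_sub]; exact toNat_natCast_sub O d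

/-- Length of a decoded row. [folklore] -/
theorem length_unpackZ (B O : ℕ) : ∀ (r k : ℕ), (RungCert.unpackZ B O r k).length = k
  | r, 0 => rfl
  | r, k + 1 => by simp [RungCert.unpackZ, length_unpackZ B O (r / B) k]

/-- The step of the fused pass in notation. [folklore] -/
theorem fusedGo_succ (B O W k r pP pM w bP bM : ℕ) :
    fusedGo B O W (k + 1) r pP pM w bP bM =
      fusedGo B O W k (r / B) (pP + (r % B - O) * w) (pM + (O - r % B) * w) (w * W) (bP * W + (r % B - O))
        (bM * W + (O - r % B)) := rfl

/-- **Invariant of the fused pass**: from the state `(pP, pM, w, bP, bM)` it returns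
`(pP + w·packN a⁺, pM + w·packN a⁻, packAccN bP a⁺, packAccN bM a⁻)` for the decoded digits `a = unpackZ B O r k`. [folklore] -/
theorem fusedGo_eq (B O W : ℕ) : ∀ (k r pP pM w bP bM : ℕ),
    fusedGo B O W k r pP pM w bP bM =
      (pP + w * packN W (posPart (RungCert.unpackZ B O r k)), pM + w * packN W (negPart (RungCert.unpackZ B O r k)),
        packAccN W bP (posPart (RungCert.unpackZ B O r k)), packAccN W bM (negPart (RungCert.unpackZ B O r k)))
  | 0, r, pP, pM, w, bP, bM => by simp [fusedGo, RungCert.unpackZ, posPart, negPart, packN, packAccN]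
  | k + 1, r, pP, pM, w, bP, bM => by
      rw [fusedGo_succ, fusedGo_eq B O W k]
      simp only [RungCert.unpackZ, posPart, negPart, packN, packAccN, toNat_natCast_sub, toNat_neg_natCast_sub]
      refine Prod.ext ?_ (Prod.ext ?_ rfl)
      · dsimp only; ring
      · dsimp only; ring

/-- ★ **The fused record is `mkKRec` of the decoded row** (`k ≤ n`). [cite: GathenGerhard2013ModernComputerAlgebra, §8.4] -/
theorem mkKRecPacked_eq {B O W n r k : ℕ} (hk : k ≤ n) :
    mkKRecPacked B O W n r k = mkKRec W n (RungCert.unpackZ B O r k) := by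
  have hP : (posPart (RungCert.unpackZ B O r k)).length = k := by rw [length_posPart, length_unpackZ]
  have hM : (negPart (RungCert.unpackZ B O r k)).length = k := by rw [length_negPart, length_unpackZ]
  unfold mkKRecPacked mkKRec
  simp only [fusedGo_eq, zero_add, one_mul]
  rw [← packAccN_mul_pow_eq_packRevN W n _ (by rw [hP]; exact hk),
    ← packAccN_mul_pow_eq_packRevN W n _ (by rw [hM]; exact hk), hP, hM]

/-- The packed records are the records of the decoded rows (all rows short). [folklore] -/
theorem ksPacked_eq {B O W n : ℕ} : ∀ (lzP : List ℕ) (i₀ : ℕ), i₀ + lzP.length ≤ n →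
    ksPacked B O W n lzP i₀ = (RungCert.unpackRowsZ B O lzP i₀).map (mkKRec W n)
  | [], _, _ => rfl
  | r :: rs, i₀, h => by
      simp only [List.length_cons] at h
      rw [ksPacked, RungCert.unpackRowsZ, List.map_cons, mkKRecPacked_eq (by omega), ksPacked_eq rs (i₀ + 1) (by omega)]

/-- Length of the decoded factor. [folklore] -/
theorem length_unpackRowsZ (B O : ℕ) : ∀ (lzP : List ℕ) (i₀ : ℕ), (RungCert.unpackRowsZ B O lzP i₀).length = lzP.length
  | [], _ => rfl
  | r :: rs, i₀ => by simp [RungCert.unpackRowsZ, length_unpackRowsZ B O rs (i₀ + 1)]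

/-- ★ **A packed-row chunk decides its rows** — for the decoded factor `Lz = unpackRowsZ B O lzP 0`, given ONCE its shape guards
(`lzOK`, `absBoundOK`) and the capacity `N·Mx² < W`. [folklore] -/
theorem zrowW_of_rowsKP {N : ℕ} {utab : List (List FI)} {lzP : List ℕ} {lamZ : ℤ} {B O W Mx i₀ cnt : ℕ}
    (hlz : lzOK (RungCert.unpackRowsZ B O lzP 0) N = true) (hab : absBoundOK Mx (RungCert.unpackRowsZ B O lzP 0) = true)
    (hcap : N * Mx * Mx < W) (h : zcheckRowsKP N utab lzP lamZ B O W i₀ cnt = true) {i : ℕ} (h1 : i₀ ≤ i)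
    (h2 : i < i₀ + cnt) (hi : i < N) : zrowW N utab (RungCert.unpackRowsZ B O lzP 0) lamZ i = true := by
  simp only [zcheckRowsKP, Bool.and_eq_true, decide_eq_true_eq] at h
  obtain ⟨⟨⟨hlen, hLz⟩, hNpos⟩, hall⟩ := h
  obtain ⟨t, rfl⟩ : ∃ t, i = i₀ + t := ⟨i - i₀, by omega⟩
  have ht := of_rall hall (k := t) (by omega)
  rw [ksPacked_eq lzP 0 (by omega), zrowSK_eq_zrowS hNpos hlz hab hcap] at ht
  exact zrowW_of_zrowS hlen (by rw [length_unpackRowsZ, hLz]) hi ht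

end Summit.RiemannHypothesis.RiemannHypothesis.Theorems.IntegerScrew.RungCert
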